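import Summits.CriticalPhenomena.PercolationContinuityZ3.Theorems.PercNearOneGluingNoHeavyQuantSGCLightCellsBoth
import HarnessLib

/-!
# QUANT lane R8, T-DEC, leg (III), general second factor of `SingleGateConvClosed`: the light-pair residue when BOTH factors are
# AD3⁺-decomposed — assembly (companion of `…QuantSGCLightCellsBoth`): cell L3 for a decomposed first factor, and
# `CW + PP + PT + TT ⟹ SingleGateConvClosed` for every pair of AD3⁺-decomposed factors

builds on p205010 (kernel theorem, internal audit signed; external expert review pending)

Support file (`--supports stmt-CriticalPhenomena-4575`), QUANT lane, TYPER seat prim-quant-stmt (gen 31), rung R8 of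
`run/shared/lean/prim/quant/LADDER.md`.  Theorems only, standard axioms, no sorries, no definitions.  The cells `SGCLightPairPair` (PP),
`SGCLightPairTriple` (PT), `SGCLightTripleTriple` (TT), the bookkeeping lemmas and `sgcLightPair_of_cells_left` (cell L2 for an
AD3⁺-decomposed first factor ⟸ CW + PP + PT) are in `…QuantSGCLightCellsBoth`; here:
* **`LawDec.sgcLightTriple_of_cells_left`** — `WindowMixDEC → SGCLightPairTriple → SGCLightTripleTriple →` the conclusion of cell L3
  (`SGCLightTriple`) for `(μ₁, triple)` whenever `μ₁` is AD3⁺-decomposed (heavy components → CW with the triple as the admissible first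
  factor; light pairs → PT through `lconv_comm`; triples → TT).
* **`LawDec.singleGateConvClosed_of_bothLightCells`** — `WindowMixDEC → PP → PT → TT →` the conclusion of `SingleGateConvClosed` for
  `(μ₁, μ₂)` whenever BOTH factors are AD3⁺-decomposed (`μ₁` keeps SGC's own hypotheses, which CW needs for the heavy components of `μ₂`).
CHAIN OF RECORD: SGC ⟸[one factor AD3⁺] CW + L2 + L3 (typer g30, `singleGateConvClosed_of_lightCells` / `_left`), and for the other factor
AD3⁺ as well: L2 ⟸ CW + PP + PT, L3 ⟸ CW + PT + TT, i.e. SGC ⟸[both AD3⁺] CW + PP + PT + TT — three explicit finite-parameter cells.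
HONEST STATUS: NOT covered — pairs with a factor admitting no AD3⁺ decomposition (arm-2 g35's top-affordability-tight 4-atom vertex);
`SingleGateConvClosed`, `WindowMixDEC`, L2, L3, PP, PT, TT, `GateMove`, `TreeDEC`, `FarTreeRow` are OPEN; nothing here is a published result;
RATE class log\* / honest sentence unchanged.

[this work]; hooks: prim-quant-arm-2 g35, cells L2/L3: prim-quant-stmt g30, SGC: prim-quant-lead g28 (this lane).  The gluing rows served
[cite: KozmaNitzan2024, Conjecture 3 (p. 15)]; product measure [cite: Grimmett1999, §1.3 p. 10].
-/

noncomputable section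

namespace Summit.CriticalPhenomena.PercolationContinuityZ3.Theorems

namespace Quant

open Finset

/-- two-point law notation `TP[lo, hi, g, h] = g·[h = hi] + (1 − g)·[h = lo]` (as in the lane's other files). -/
local notation3 "TP[" lo ", " hi ", " g ", " h "]" =>
  (g : ℝ) * (if (h : ℕ) = (hi : ℕ) then (1 : ℝ) else 0) + (1 - (g : ℝ)) * (if (h : ℕ) = (lo : ℕ) then (1 : ℝ) else 0)

/-- three-atom law notation `TR[s₁, s₂, s₃, p₁, p₂, p₃, h] = p₁·[h = s₁] + p₂·[h = s₂] + p₃·[h = s₃]`. -/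
local notation3 "TR[" s₁ ", " s₂ ", " s₃ ", " p₁ ", " p₂ ", " p₃ ", " h "]" =>
  (p₁ : ℝ) * (if (h : ℕ) = (s₁ : ℕ) then (1 : ℝ) else 0) + (p₂ : ℝ) * (if (h : ℕ) = (s₂ : ℕ) then (1 : ℝ) else 0)
    + (p₃ : ℝ) * (if (h : ℕ) = (s₃ : ℕ) then (1 : ℝ) else 0)

namespace LawDec

/-! ### Cell L3 for an AD3⁺-decomposed first factor -/

/-- **CELL L3 FOR AN AD3⁺-DECOMPOSED FIRST FACTOR ⟸ CW + PT + TT.**  As `sgcLightPair_of_cells_left`, with the second factor ONE admissible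
non-heavy-decomposable triple `p₁δ_{s₁} + p₂δ_{s₂} + p₃δ_{s₃}` on `{0..M₂}` (cell L3's datum); heavy components of `μ₁` → CW (the triple
being an admissible first factor), light pairs → PT (after `lconv_comm`), triples → TT.  Conclusion: `gate_q(μ₁ ∗ μ₂)` DEC at every layer
`j′ < M₁ + M₂` — L3's conclusion for this pair of factors. [this work] -/
theorem sgcLightTriple_of_cells_left (hCW : WindowMixDEC) (hPT : SGCLightPairTriple) (hTT : SGCLightTripleTriple)
    (y q p₁ p₂ p₃ T₂ T₁ : ℝ) (M₁ M₂ s₁ s₂ s₃ : ℕ) (μ₁ : ℕ → ℝ) {κ : Type} [Fintype κ] (v : κ → ℝ) (ω : κ → ℕ → ℝ)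
    (hy0 : 0 < y) (hy1 : y < 1) (hq0 : 0 < q) (hq1 : q ≤ 1)
    (h12 : s₁ < s₂) (h23 : s₂ < s₃) (h3 : s₃ ≤ M₂) (hp₁ : 0 < p₁) (hp₂ : 0 < p₂) (hp₃ : 0 < p₃) (hp : p₁ + p₂ + p₃ = 1)
    (hT : p₁ * (s₁ : ℝ) + p₂ * (s₂ : ℝ) + p₃ * (s₃ : ℝ) = T₂) (hta₂ : y * (M₂ : ℝ) ≤ q * T₂)
    (hnotHD : (s₂ : ℝ) ≤ T₂ ∧ q * (T₂ - s₂) < y * ((s₃ : ℝ) - s₂) ∨ T₂ < (s₂ : ℝ) ∧ q * (T₂ - s₁) < y * ((s₃ : ℝ) - s₁))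
    (hD₂ : ∀ j', j' < M₂ → DECAt y j' M₂ (gate (fun h => TR[s₁, s₂, s₃, p₁, p₂, p₃, h]) q))
    (hta₁ : y * (M₁ : ℝ) ≤ q * T₁)
    (hv0 : ∀ k, 0 ≤ v k) (hv1 : ∑ k, v k = 1) (hμ₁ : ∀ h, μ₁ h = ∑ k, v k * ω k h)
    (hcomp : ∀ k, 0 < v k →
      (∃ (lo' hi' : ℕ) (γ' : ℝ), lo' ≤ hi' ∧ hi' ≤ M₁ ∧ 0 ≤ γ' ∧ γ' ≤ 1 ∧ y ≤ q * γ' ∧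
          (lo' : ℝ) + ((hi' : ℝ) - lo') * γ' = T₁ ∧ ω k = fun h => TP[lo', hi', γ', h]) ∨
      (∃ (lo' hi' : ℕ) (γ' : ℝ), lo' < hi' ∧ hi' ≤ M₁ ∧ 0 ≤ γ' ∧ γ' ≤ 1 ∧ q * γ' < y ∧
          (lo' : ℝ) + ((hi' : ℝ) - lo') * γ' = T₁ ∧ (∀ j', j' < M₁ → DECAt y j' M₁ (gate (fun h => TP[lo', hi', γ', h]) q)) ∧
          ω k = fun h => TP[lo', hi', γ', h]) ∨
      (∃ (r₁ r₂ r₃ : ℕ) (w₁ w₂ w₃ : ℝ), r₁ < r₂ ∧ r₂ < r₃ ∧ r₃ ≤ M₁ ∧ 0 < w₁ ∧ 0 < w₂ ∧ 0 < w₃ ∧ w₁ + w₂ + w₃ = 1 ∧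
          w₁ * (r₁ : ℝ) + w₂ * (r₂ : ℝ) + w₃ * (r₃ : ℝ) = T₁ ∧
          ((r₂ : ℝ) ≤ T₁ ∧ q * (T₁ - r₂) < y * ((r₃ : ℝ) - r₂) ∨ T₁ < (r₂ : ℝ) ∧ q * (T₁ - r₁) < y * ((r₃ : ℝ) - r₁)) ∧
          (∀ j', j' < M₁ → DECAt y j' M₁ (gate (fun h => TR[r₁, r₂, r₃, w₁, w₂, w₃, h]) q)) ∧
          ω k = fun h => TR[r₁, r₂, r₃, w₁, w₂, w₃, h])) :
    ∀ j', j' < M₁ + M₂ → DECAt y j' (M₁ + M₂) (gate (lconv M₁ M₂ μ₁ (fun h => TR[s₁, s₂, s₃, p₁, p₂, p₃, h])) q) := by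
  -- the triple as a (first) factor: its laws
  obtain ⟨hτ0, hτM, hτ1, hτmean⟩ := triple_laws' p₁ p₂ p₃ T₂ M₂ s₁ s₂ s₃ (by omega) (by omega) h3 hp₁.le hp₂.le hp₃.le hp hT
  have hta₂' : y * (M₂ : ℝ) ≤ q * ∑ h ∈ Finset.range (M₂ + 1), (h : ℝ) * TR[s₁, s₂, s₃, p₁, p₂, p₃, h] := by
    rw [hτmean]; exact hta₂
  -- laws of the components of `μ₁`
  have hlaw : ∀ k, 0 < v k →
      (∑ h ∈ Finset.range (M₁ + 1), ω k h = 1) ∧ (∑ h ∈ Finset.range (M₁ + 1), (h : ℝ) * ω k h = T₁) := by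
    intro k hk
    rcases hcomp k hk with ⟨lo', hi', γ', hlohi', hhi', hγ0', hγ1', -, hmean, hω⟩ |
      ⟨lo', hi', γ', hlohi', hhi', hγ0', hγ1', -, hmean, -, hω⟩ | ⟨r₁, r₂, r₃, w₁, w₂, w₃, h12', h23', h3', -, -, -, hw, hT', -, -, hω⟩
    · obtain ⟨-, -, h1, h2⟩ := tp_laws M₁ lo' hi' γ' hγ0' hγ1' hlohi' hhi'
      rw [hω]; exact ⟨h1, hmean ▸ h2⟩
    · obtain ⟨-, -, h1, h2⟩ := tp_laws M₁ lo' hi' γ' hγ0' hγ1' hlohi'.le hhi'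
      rw [hω]; exact ⟨h1, hmean ▸ h2⟩
    · rw [hω]; exact triple_laws w₁ w₂ w₃ T₁ M₁ r₁ r₂ r₃ (by omega) (by omega) h3' hw hT'
  -- swapped frame: first factor the triple, second factor `μ₁` decomposed
  have hswap : ∀ j', j' < M₂ + M₁ → DECAt y j' (M₂ + M₁)
      (gate (lconv M₂ M₁ (fun h => TR[s₁, s₂, s₃, p₁, p₂, p₃, h]) μ₁) q) := by
    refine decAt_gate_lconv_of_pieces_right y q T₁ M₂ M₁ (fun h => TR[s₁, s₂, s₃, p₁, p₂, p₃, h]) μ₁ v ω hτ1 hv0 hv1 hμ₁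
      (fun k hk => (hlaw k hk).1) (fun k hk => (hlaw k hk).2) ?_
    intro k hk
    rcases hcomp k hk with ⟨lo', hi', γ', hlohi', hhi', hγ0', hγ1', hheavy, hmean, hω⟩ |
      ⟨lo', hi', γ', hlohi', hhi', hγ0', hγ1', hlight', hmean, hD', hω⟩ |
      ⟨r₁, r₂, r₃, w₁, w₂, w₃, h12', h23', h3', hw₁, hw₂, hw₃, hw, hT', hnotHD', hD', hω⟩
    · -- heavy component of `μ₁`: CW with the triple as the (admissible) first factor
      have h := singleGateConvClosed_heavyMix_of_windowMix hCW y q T₁ M₂ M₁ (fun h => TR[s₁, s₂, s₃, p₁, p₂, p₃, h]) (ι := Unit)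
        (fun _ => (1 : ℝ)) (fun _ => γ') (fun _ => lo') (fun _ => hi') hy0 hy1 hq0 hq1 hτ0 hτM hτ1 hta₂' hD₂ (fun _ => zero_le_one)
        (by simp) (fun _ => hγ1') (fun _ => hheavy) (fun _ => hlohi') (fun _ => hhi') (fun _ => hmean)
      have e : (fun h => ∑ _i : Unit, (1 : ℝ) * TP[lo', hi', γ', h]) = ω k := by
        rw [hω]; funext h; simp only [Finset.univ_unique, Finset.sum_singleton, one_mul]
      rw [← e]; exact h
    · -- light pair component: cell PT, read through `lconv_comm`
      rw [hω]
      intro j' hj'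
      have h := hPT y q γ' p₁ p₂ p₃ T₂ M₁ M₂ lo' hi' s₁ s₂ s₃ hy0 hy1 hq0 hq1 hlohi' hhi' hγ0' hγ1' hlight' (hmean ▸ hta₁) hD' h12 h23
        h3 hp₁ hp₂ hp₃ hp hT hta₂ hnotHD hD₂ j' (by omega)
      rw [lconv_comm, Nat.add_comm]; exact h
    · -- light triple component: cell TT
      rw [hω]
      exact hTT y q p₁ p₂ p₃ T₂ w₁ w₂ w₃ T₁ M₂ M₁ s₁ s₂ s₃ r₁ r₂ r₃ hy0 hy1 hq0 hq1 h12 h23 h3 hp₁ hp₂ hp₃ hp hT hta₂ hnotHD hD₂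
        h12' h23' h3' hw₁ hw₂ hw₃ hw hT' hta₁ hnotHD' hD'
  intro j' hj'
  have h := hswap j' (by omega)
  rw [lconv_comm, Nat.add_comm]; exact h

/-! ### The assembly: both factors AD3⁺-decomposed -/

/-- **`WindowMixDEC ∧ PP ∧ PT ∧ TT ⟹ SingleGateConvClosed` FOR EVERY PAIR OF AD3⁺-DECOMPOSED FACTORS.**  In SGC's binder for `μ₁` (floor
`0 < y < 1`, gate `0 < q ≤ 1`, `μ₁` a probability law on `{0..M₁}` whose gated version is DEC at every layer `j′ < M₁`), let
`μ₁ = Σ_k v_k·ω_k` and `μ₂ = Σ_k v′_k·ω′_k` be finite mixtures (`v, v′ ≥ 0`, `Σ = 1`) whose charged components are laws on `{0..M₁}`, resp.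
`{0..M₂}`, of common means `T₁`, `T₂` with `y·Mᵢ ≤ q·Tᵢ`, each a heavy pair, an admissible light pair or an admissible non-HD triple
(AD3⁺ decompositions of both factors).  Then `gate_q(μ₁ ∗ μ₂)` is DEC at every layer `j′ < M₁ + M₂` — SGC's conclusion: heavy components of
`μ₂` by CW (`singleGateConvClosed_heavyMix_of_windowMix`, using `μ₁`'s own DEC data), light pairs by `sgcLightPair_of_cells_left`, triples
by `sgcLightTriple_of_cells_left`.  So, given CW, SGC for all pairs of AD3⁺-decomposable factors is EXACTLY the three explicit cells. [this work] -/
theorem singleGateConvClosed_of_bothLightCells (hCW : WindowMixDEC) (hPP : SGCLightPairPair) (hPT : SGCLightPairTriple)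
    (hTT : SGCLightTripleTriple)
    (y q T₁ T₂ : ℝ) (M₁ M₂ : ℕ) (μ₁ μ₂ : ℕ → ℝ) {κ : Type} [Fintype κ] (v : κ → ℝ) (ω : κ → ℕ → ℝ)
    {κ' : Type} [Fintype κ'] (v' : κ' → ℝ) (ω' : κ' → ℕ → ℝ)
    (hy0 : 0 < y) (hy1 : y < 1) (hq0 : 0 < q) (hq1 : q ≤ 1)
    (hμ0 : ∀ h, 0 ≤ μ₁ h) (hμM : ∀ h, M₁ < h → μ₁ h = 0)
    (hD : ∀ j', j' < M₁ → DECAt y j' M₁ (gate μ₁ q))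
    (hta₁ : y * (M₁ : ℝ) ≤ q * T₁) (hta₂ : y * (M₂ : ℝ) ≤ q * T₂)
    (hv0 : ∀ k, 0 ≤ v k) (hv1 : ∑ k, v k = 1) (hμ₁ : ∀ h, μ₁ h = ∑ k, v k * ω k h)
    (hcomp₁ : ∀ k, 0 < v k →
      (∃ (lo hi : ℕ) (γ : ℝ), lo ≤ hi ∧ hi ≤ M₁ ∧ 0 ≤ γ ∧ γ ≤ 1 ∧ y ≤ q * γ ∧
          (lo : ℝ) + ((hi : ℝ) - lo) * γ = T₁ ∧ ω k = fun h => TP[lo, hi, γ, h]) ∨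
      (∃ (lo hi : ℕ) (γ : ℝ), lo < hi ∧ hi ≤ M₁ ∧ 0 ≤ γ ∧ γ ≤ 1 ∧ q * γ < y ∧
          (lo : ℝ) + ((hi : ℝ) - lo) * γ = T₁ ∧ (∀ j', j' < M₁ → DECAt y j' M₁ (gate (fun h => TP[lo, hi, γ, h]) q)) ∧
          ω k = fun h => TP[lo, hi, γ, h]) ∨
      (∃ (s₁ s₂ s₃ : ℕ) (p₁ p₂ p₃ : ℝ), s₁ < s₂ ∧ s₂ < s₃ ∧ s₃ ≤ M₁ ∧ 0 < p₁ ∧ 0 < p₂ ∧ 0 < p₃ ∧ p₁ + p₂ + p₃ = 1 ∧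
          p₁ * (s₁ : ℝ) + p₂ * (s₂ : ℝ) + p₃ * (s₃ : ℝ) = T₁ ∧
          ((s₂ : ℝ) ≤ T₁ ∧ q * (T₁ - s₂) < y * ((s₃ : ℝ) - s₂) ∨ T₁ < (s₂ : ℝ) ∧ q * (T₁ - s₁) < y * ((s₃ : ℝ) - s₁)) ∧
          (∀ j', j' < M₁ → DECAt y j' M₁ (gate (fun h => TR[s₁, s₂, s₃, p₁, p₂, p₃, h]) q)) ∧
          ω k = fun h => TR[s₁, s₂, s₃, p₁, p₂, p₃, h]))
    (hv'0 : ∀ k, 0 ≤ v' k) (hv'1 : ∑ k, v' k = 1) (hμ₂ : ∀ h, μ₂ h = ∑ k, v' k * ω' k h)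
    (hcomp₂ : ∀ k, 0 < v' k →
      (∃ (lo hi : ℕ) (γ : ℝ), lo ≤ hi ∧ hi ≤ M₂ ∧ 0 ≤ γ ∧ γ ≤ 1 ∧ y ≤ q * γ ∧
          (lo : ℝ) + ((hi : ℝ) - lo) * γ = T₂ ∧ ω' k = fun h => TP[lo, hi, γ, h]) ∨
      (∃ (lo hi : ℕ) (γ : ℝ), lo < hi ∧ hi ≤ M₂ ∧ 0 ≤ γ ∧ γ ≤ 1 ∧ q * γ < y ∧
          (lo : ℝ) + ((hi : ℝ) - lo) * γ = T₂ ∧ (∀ j', j' < M₂ → DECAt y j' M₂ (gate (fun h => TP[lo, hi, γ, h]) q)) ∧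
          ω' k = fun h => TP[lo, hi, γ, h]) ∨
      (∃ (s₁ s₂ s₃ : ℕ) (p₁ p₂ p₃ : ℝ), s₁ < s₂ ∧ s₂ < s₃ ∧ s₃ ≤ M₂ ∧ 0 < p₁ ∧ 0 < p₂ ∧ 0 < p₃ ∧ p₁ + p₂ + p₃ = 1 ∧
          p₁ * (s₁ : ℝ) + p₂ * (s₂ : ℝ) + p₃ * (s₃ : ℝ) = T₂ ∧
          ((s₂ : ℝ) ≤ T₂ ∧ q * (T₂ - s₂) < y * ((s₃ : ℝ) - s₂) ∨ T₂ < (s₂ : ℝ) ∧ q * (T₂ - s₁) < y * ((s₃ : ℝ) - s₁)) ∧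
          (∀ j', j' < M₂ → DECAt y j' M₂ (gate (fun h => TR[s₁, s₂, s₃, p₁, p₂, p₃, h]) q)) ∧
          ω' k = fun h => TR[s₁, s₂, s₃, p₁, p₂, p₃, h])) :
    ∀ j', j' < M₁ + M₂ → DECAt y j' (M₁ + M₂) (gate (lconv M₁ M₂ μ₁ μ₂) q) := by
  -- laws of the components of both factors, and of `μ₁` itself
  have hlaw₁ : ∀ k, 0 < v k →
      (∑ h ∈ Finset.range (M₁ + 1), ω k h = 1) ∧ (∑ h ∈ Finset.range (M₁ + 1), (h : ℝ) * ω k h = T₁) := by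
    intro k hk
    rcases hcomp₁ k hk with ⟨lo, hi, γ, hlohi, hhi, hγ0, hγ1, -, hmean, hω⟩ | ⟨lo, hi, γ, hlohi, hhi, hγ0, hγ1, -, hmean, -, hω⟩ |
      ⟨s₁, s₂, s₃, p₁, p₂, p₃, h12, h23, h3, -, -, -, hp, hT, -, -, hω⟩
    · obtain ⟨-, -, h1, h2⟩ := tp_laws M₁ lo hi γ hγ0 hγ1 hlohi hhi
      rw [hω]; exact ⟨h1, hmean ▸ h2⟩
    · obtain ⟨-, -, h1, h2⟩ := tp_laws M₁ lo hi γ hγ0 hγ1 hlohi.le hhi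
      rw [hω]; exact ⟨h1, hmean ▸ h2⟩
    · rw [hω]; exact triple_laws p₁ p₂ p₃ T₁ M₁ s₁ s₂ s₃ (by omega) (by omega) h3 hp hT
  have hlaw₂ : ∀ k, 0 < v' k →
      (∑ h ∈ Finset.range (M₂ + 1), ω' k h = 1) ∧ (∑ h ∈ Finset.range (M₂ + 1), (h : ℝ) * ω' k h = T₂) := by
    intro k hk
    rcases hcomp₂ k hk with ⟨lo, hi, γ, hlohi, hhi, hγ0, hγ1, -, hmean, hω⟩ | ⟨lo, hi, γ, hlohi, hhi, hγ0, hγ1, -, hmean, -, hω⟩ |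
      ⟨s₁, s₂, s₃, p₁, p₂, p₃, h12, h23, h3, -, -, -, hp, hT, -, -, hω⟩
    · obtain ⟨-, -, h1, h2⟩ := tp_laws M₂ lo hi γ hγ0 hγ1 hlohi hhi
      rw [hω]; exact ⟨h1, hmean ▸ h2⟩
    · obtain ⟨-, -, h1, h2⟩ := tp_laws M₂ lo hi γ hγ0 hγ1 hlohi.le hhi
      rw [hω]; exact ⟨h1, hmean ▸ h2⟩
    · rw [hω]; exact triple_laws p₁ p₂ p₃ T₂ M₂ s₁ s₂ s₃ (by omega) (by omega) h3 hp hT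
  obtain ⟨hμ1, hμmean⟩ := mixture_laws M₁ T₁ μ₁ v ω hv0 hv1 hμ₁ (fun k hk => (hlaw₁ k hk).1) (fun k hk => (hlaw₁ k hk).2)
  have hta : y * (M₁ : ℝ) ≤ q * ∑ h ∈ Finset.range (M₁ + 1), (h : ℝ) * μ₁ h := by rw [hμmean]; exact hta₁
  -- decompose the second factor
  refine decAt_gate_lconv_of_pieces_right y q T₂ M₁ M₂ μ₁ μ₂ v' ω' hμ1 hv'0 hv'1 hμ₂ (fun k hk => (hlaw₂ k hk).1)
    (fun k hk => (hlaw₂ k hk).2) ?_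
  intro k hk
  rcases hcomp₂ k hk with ⟨lo, hi, γ, hlohi, hhi, hγ0, hγ1, hheavy, hmean, hω⟩ |
    ⟨lo, hi, γ, hlohi, hhi, hγ0, hγ1, hlight, hmean, hD₂, hω⟩ |
    ⟨s₁, s₂, s₃, p₁, p₂, p₃, h12, h23, h3, hp₁, hp₂, hp₃, hp, hT, hnotHD, hD₂, hω⟩
  · -- (H) heavy component of `μ₂`: CW with `μ₁` general
    have h := singleGateConvClosed_heavyMix_of_windowMix hCW y q T₂ M₁ M₂ μ₁ (ι := Unit) (fun _ => (1 : ℝ)) (fun _ => γ)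
      (fun _ => lo) (fun _ => hi) hy0 hy1 hq0 hq1 hμ0 hμM hμ1 hta hD (fun _ => zero_le_one) (by simp) (fun _ => hγ1)
      (fun _ => hheavy) (fun _ => hlohi) (fun _ => hhi) (fun _ => hmean)
    have e : (fun h => ∑ _i : Unit, (1 : ℝ) * TP[lo, hi, γ, h]) = ω' k := by
      rw [hω]; funext h; simp only [Finset.univ_unique, Finset.sum_singleton, one_mul]
    rw [← e]; exact h
  · -- (L2) light pair component of `μ₂`: the first factor is AD3⁺-decomposed
    rw [hω]
    exact sgcLightPair_of_cells_left hCW hPP hPT y q γ T₁ M₁ M₂ lo hi μ₁ v ω hy0 hy1 hq0 hq1 hlohi hhi hγ0 hγ1 hlight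
      (hmean ▸ hta₂) hD₂ hta₁ hv0 hv1 hμ₁ hcomp₁
  · -- (L3) light triple component of `μ₂`
    rw [hω]
    exact sgcLightTriple_of_cells_left hCW hPT hTT y q p₁ p₂ p₃ T₂ T₁ M₁ M₂ s₁ s₂ s₃ μ₁ v ω hy0 hy1 hq0 hq1 h12 h23 h3 hp₁ hp₂ hp₃
      hp hT hta₂ hnotHD hD₂ hta₁ hv0 hv1 hμ₁ hcomp₁

end LawDec

end Quant

end Summit.CriticalPhenomena.PercolationContinuityZ3.Theorems
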